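import Literature.NumberTheory.EllipticCurves.Gamma0EisensteinWeightOneContinuation
import Mathlib.NumberTheory.DirichletCharacter.GaussSum
import Mathlib.NumberTheory.TsumDivisorsAntidiagonal
import HarnessLib

/-!
# The `q`-expansion of Hecke's weight-one Eisenstein series at `s = 0`

Topic `Literature/NumberTheory/EllipticCurves`; namespace
`Literature.NumberTheory.EllipticCurves.ModularForms`; theorems only (no definition, no named
fact).

For a PRIMITIVE odd Dirichlet character `χ` mod `M` and `z ∈ ℍ`, `q = e^{2πiz}`, the value at
`s = 0` of Hecke's continued sum (`eisensteinOneCont_zero`,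
`Gamma0EisensteinWeightOneContinuation.lean`) has the `q`-expansion

  **`G̃(z, 0) = 2 L(χ, 1) - (4πi τ(χ)/M) ∑_{m ≥ 1} ( ∑_{d ∣ m} χ̄(d) ) qᵐ`**
  (`eisensteinOneCont_zero_qExpansion`)

with the Gauss sum `τ(χ) = ∑_{a mod M} χ(a) e^{2πia/M}` (`gaussSum χ ZMod.stdAddChar`) and
`χ̄ = χ⁻¹`. Steps, all proved:

* `pi_mul_cot_pi_eq` — `π cot(πτ) = -πi - 2πi ∑_{k ≥ 0} e^{2πi(k+1)τ}` (`τ ∈ ℍ`; Mathlib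
  `pi_mul_cot_pi_q_exp`);
* `sum_chiZ_mul_exp_eq_gaussSum` — **`∑_{r mod M} χ(r) e^{2πijr/M} = χ̄(j) τ(χ)`** for every
  `j ∈ ℕ` (Mathlib `gaussSum_mulShift_of_isPrimitive`);
* `rowValue_zero_eq` — the `n`-th row at `s = 0`:
  `∑_{r mod M} χ(r) (π/M) cot(π((n+1)z + r/M)) = -(2πi τ(χ)/M) ∑_{k ≥ 0} χ̄(k+1) q^{(k+1)(n+1)}`;
* `tsum_tsum_mul_pow_eq_tsum_divisorSum` —
  **`∑_{a,b ≥ 1} w(b) q^{ab} = ∑_{m ≥ 1} (∑_{d∣m} w(d)) qᵐ`** for a bounded weight `w`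
  (`|q| < 1`; Mathlib `sigmaAntidiagonalEquivProd`).

This is the classical expansion of the weight-one Eisenstein series with character (Hecke 1927,
(13); Miyake Thm 7.2.13 with `k = 1`; Diamond–Shurman §4.8): up to the factor `2 L(χ, 1)` its
coefficients are the twisted divisor sums `σ_{χ̄}(m)`.

## References

* E. Hecke, *Theorie der Eisensteinschen Reihen höherer Stufe…*, Abh. Math. Sem. Hamburg 5 (1927).
* T. Miyake, *Modular Forms*, Springer (1989), Thm 7.2.13.
* F. Diamond, J. Shurman, *A First Course in Modular Forms*, Springer (2005), §4.8.
-/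

noncomputable section

open Complex Filter
open scoped Topology Real UpperHalfPlane

namespace Literature.NumberTheory.EllipticCurves.ModularForms

/-! ### The cotangent `q`-expansion -/

/-- `π cot(πτ) = -πi - 2πi ∑_{k ≥ 0} e^{2πi(k+1)τ}` for `τ ∈ ℍ`. [folklore] -/
theorem pi_mul_cot_pi_eq (τ : ℍ) :
    π * Complex.cot (π * τ) =
      -π * Complex.I -
        2 * π * Complex.I * ∑' k : ℕ, Complex.exp (2 * π * Complex.I * τ) ^ (k + 1) := by
  have hq : ‖Complex.exp (2 * π * Complex.I * τ)‖ < 1 := UpperHalfPlane.norm_exp_two_pi_I_lt_one τ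
  have hs : Summable fun k : ℕ ↦ Complex.exp (2 * π * Complex.I * τ) ^ k :=
    summable_geometric_of_norm_lt_one hq
  rw [pi_mul_cot_pi_q_exp τ, hs.tsum_eq_zero_add, pow_zero]
  ring

/-- The geometric tail is summable. [folklore] -/
theorem summable_exp_pow_succ (τ : ℍ) :
    Summable fun k : ℕ ↦ Complex.exp (2 * π * Complex.I * τ) ^ (k + 1) := by
  have hq : ‖Complex.exp (2 * π * Complex.I * τ)‖ < 1 := UpperHalfPlane.norm_exp_two_pi_I_lt_one τ
  exact (summable_nat_add_iff 1).mpr (summable_geometric_of_norm_lt_one hq)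

/-! ### Gauss sums over `Fin M` -/

variable {M : ℕ} [NeZero M] (χ : DirichletCharacter ℂ M)

/-- Sums over `Fin M` of functions of the residue are sums over `ZMod M`. [folklore] -/
theorem sum_fin_eq_sum_zmod (F : ZMod M → ℂ) :
    ∑ r : Fin M, F (((r : ℕ) : ℤ) : ZMod M) = ∑ a : ZMod M, F a := by
  obtain ⟨n, rfl⟩ : ∃ n, M = n + 1 := Nat.exists_eq_succ_of_ne_zero (NeZero.ne M)
  refine Fintype.sum_bijective (fun i : Fin (n + 1) ↦ (show ZMod (n + 1) from i))
    Function.bijective_id _ _ fun i ↦ ?_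
  rw [Int.cast_natCast]
  exact congrArg F (ZMod.natCast_zmod_val (show ZMod (n + 1) from i))

/-- **`∑_{r mod M} χ(r) e^{2πi j r/M} = χ̄(j) τ(χ)`** for a primitive `χ` and every `j ∈ ℕ`
(`τ(χ) = gaussSum χ stdAddChar`; for `(j, M) > 1` both sides vanish). [folklore] -/
theorem sum_chiZ_mul_exp_eq_gaussSum (hprim : χ.IsPrimitive) (j : ℕ) :
    ∑ r : Fin M, chiZ χ r * Complex.exp (2 * π * Complex.I * ((j : ℂ) * r) / M) =
      χ⁻¹ (j : ZMod M) * gaussSum χ (ZMod.stdAddChar (N := M)) := by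
  rw [← gaussSum_mulShift_of_isPrimitive (ZMod.stdAddChar (N := M)) hprim (j : ZMod M), gaussSum]
  rw [← sum_fin_eq_sum_zmod
    (fun a : ZMod M ↦ χ a * (ZMod.stdAddChar (N := M)).mulShift (j : ZMod M) a)]
  refine Finset.sum_congr rfl fun r _ ↦ ?_
  rw [chiZ_apply, AddChar.mulShift_apply, show ((j : ZMod M)) * (((r : ℕ) : ℤ) : ZMod M) =
    (((j : ℤ) * (r : ℕ) : ℤ) : ZMod M) by push_cast; ring, ZMod.stdAddChar_coe]
  congr 2
  push_cast
  ring

/-- `∑_{r mod M} χ(r) = 0` over `Fin M` (for `χ ≠ 1`). [folklore] -/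
theorem sum_fin_chiZ_eq_zero (hχ : χ ≠ 1) : ∑ r : Fin M, chiZ χ r = 0 := by
  rw [← Finset.sum_range (fun i ↦ chiZ χ i)]
  exact sum_range_chiZ_eq_zero χ hχ

/-! ### The rows at `s = 0` as `q`-series -/

omit [NeZero M] in
/-- The class point `(n+1) z + r/M` has positive imaginary part. [folklore] -/
theorem im_classPoint_pos (n : ℕ) (z : ℍ) (r : ℕ) :
    0 < (((n : ℂ) + 1) * z + (r : ℂ) / M).im := by
  have h1 : (((n : ℂ) + 1) * z).im = ((n : ℝ) + 1) * z.im := by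
    rw [show ((n : ℂ) + 1) = (((n : ℝ) + 1 : ℝ) : ℂ) by push_cast; ring, Complex.im_ofReal_mul]
    rfl
  have h2 : ((r : ℂ) / M).im = 0 := by
    rw [show ((r : ℂ) / M) = (((r : ℝ) / M : ℝ) : ℂ) by push_cast; ring, Complex.ofReal_im]
  rw [Complex.add_im, h1, h2, add_zero]
  exact mul_pos (by positivity) z.im_pos

omit [NeZero M] in
/-- `e^{2πi(k+1)((n+1)z + r/M)} = q^{(k+1)(n+1)} e^{2πi (k+1) r/M}`. [folklore] -/
theorem exp_classPoint_pow (n : ℕ) (z : ℍ) (r k : ℕ) :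
    Complex.exp (2 * π * Complex.I * (((n : ℂ) + 1) * z + (r : ℂ) / M)) ^ (k + 1) =
      Complex.exp (2 * π * Complex.I * z) ^ ((k + 1) * (n + 1)) *
        Complex.exp (2 * π * Complex.I * ((((k + 1 : ℕ) : ℂ)) * r) / M) := by
  rw [← Complex.exp_nat_mul, ← Complex.exp_nat_mul, ← Complex.exp_add]
  congr 1
  push_cast
  ring_nf

/-- **The `n`-th row at `s = 0`**:
`∑_{r mod M} χ(r) (π/M) cot(π((n+1)z + r/M)) = -(2πi τ(χ)/M) ∑_{k ≥ 0} χ̄(k+1) q^{(k+1)(n+1)}`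
(primitive `χ ≠ 1`). [folklore] -/
theorem rowValue_zero_eq (hprim : χ.IsPrimitive) (hχ : χ ≠ 1) (n : ℕ) (z : ℍ) :
    ∑ r : Fin M, chiZ χ r * ((π / M) * Complex.cot (π * (((n : ℂ) + 1) * z + ((r : ℕ) : ℂ) / M))) =
      -(2 * π * Complex.I * gaussSum χ (ZMod.stdAddChar (N := M)) / M) *
        ∑' k : ℕ, χ⁻¹ (((k + 1 : ℕ)) : ZMod M) *
          Complex.exp (2 * π * Complex.I * z) ^ ((k + 1) * (n + 1)) := by
  have hM : (M : ℂ) ≠ 0 := by exact_mod_cast NeZero.ne M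
  -- expand each cotangent
  have hcot : ∀ r : Fin M,
      (π / M) * Complex.cot (π * (((n : ℂ) + 1) * z + ((r : ℕ) : ℂ) / M)) =
        (1 / M) * (-π * Complex.I - 2 * π * Complex.I * ∑' k : ℕ,
          Complex.exp (2 * π * Complex.I * z) ^ ((k + 1) * (n + 1)) *
            Complex.exp (2 * π * Complex.I * ((((k + 1 : ℕ) : ℂ)) * (r : ℕ)) / M)) := by
    intro r
    set τ : ℍ := ⟨((n : ℂ) + 1) * z + ((r : ℕ) : ℂ) / M, im_classPoint_pos n z r⟩ with hτ
    have h := pi_mul_cot_pi_eq τ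
    have hcoe : (τ : ℂ) = ((n : ℂ) + 1) * z + ((r : ℕ) : ℂ) / M := rfl
    rw [hcoe] at h
    simp_rw [exp_classPoint_pow n z r] at h
    rw [show (π / M : ℂ) * Complex.cot (π * (((n : ℂ) + 1) * z + ((r : ℕ) : ℂ) / M)) =
      (1 / M) * (π * Complex.cot (π * (((n : ℂ) + 1) * z + ((r : ℕ) : ℂ) / M))) by ring, h]
  simp_rw [hcot]
  -- summability of the inner series (geometric tail times a unimodular factor)
  have hsum : ∀ r : Fin M, Summable fun k : ℕ ↦
      Complex.exp (2 * π * Complex.I * z) ^ ((k + 1) * (n + 1)) *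
        Complex.exp (2 * π * Complex.I * ((((k + 1 : ℕ) : ℂ)) * (r : ℕ)) / M) := by
    intro r
    set τ : ℍ := ⟨((n : ℂ) + 1) * z + ((r : ℕ) : ℂ) / M, im_classPoint_pos n z r⟩ with hτ
    have h := summable_exp_pow_succ τ
    have hcoe : (τ : ℂ) = ((n : ℂ) + 1) * z + ((r : ℕ) : ℂ) / M := rfl
    rw [hcoe] at h
    simp_rw [exp_classPoint_pow n z r] at h
    exact h
  -- distribute the finite sum
  have hexp : ∀ r : Fin M, chiZ χ r * ((1 / M) * (-π * Complex.I - 2 * π * Complex.I * ∑' k : ℕ,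
      Complex.exp (2 * π * Complex.I * z) ^ ((k + 1) * (n + 1)) *
        Complex.exp (2 * π * Complex.I * ((((k + 1 : ℕ) : ℂ)) * (r : ℕ)) / M))) =
      (-π * Complex.I / M) * chiZ χ r - (2 * π * Complex.I / M) * ∑' k : ℕ,
        Complex.exp (2 * π * Complex.I * z) ^ ((k + 1) * (n + 1)) *
          (chiZ χ r * Complex.exp (2 * π * Complex.I * ((((k + 1 : ℕ) : ℂ)) * (r : ℕ)) / M)) := by
    intro r
    have key : ∑' k : ℕ, Complex.exp (2 * π * Complex.I * z) ^ ((k + 1) * (n + 1)) *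
        (chiZ χ r * Complex.exp (2 * π * Complex.I * ((((k + 1 : ℕ) : ℂ)) * (r : ℕ)) / M)) =
        chiZ χ r * ∑' k : ℕ, Complex.exp (2 * π * Complex.I * z) ^ ((k + 1) * (n + 1)) *
          Complex.exp (2 * π * Complex.I * ((((k + 1 : ℕ) : ℂ)) * (r : ℕ)) / M) := by
      rw [← tsum_mul_left]
      exact tsum_congr fun k ↦ by ring
    rw [key]
    ring
  simp_rw [hexp]
  rw [Finset.sum_sub_distrib, ← Finset.mul_sum, ← Finset.mul_sum, sum_fin_chiZ_eq_zero χ hχ,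
    mul_zero, zero_sub]
  -- swap the finite sum and the series, then use the Gauss sum
  rw [← Summable.tsum_finsetSum (fun r _ ↦ ((hsum r).mul_left (chiZ χ r)).congr (fun k ↦ by ring))]
  have inner : ∀ k : ℕ, ∑ r : Fin M, Complex.exp (2 * π * Complex.I * z) ^ ((k + 1) * (n + 1)) *
      (chiZ χ r * Complex.exp (2 * π * Complex.I * ((((k + 1 : ℕ) : ℂ)) * (r : ℕ)) / M)) =
      gaussSum χ (ZMod.stdAddChar (N := M)) * (χ⁻¹ (((k + 1 : ℕ)) : ZMod M) *
        Complex.exp (2 * π * Complex.I * z) ^ ((k + 1) * (n + 1))) := by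
    intro k
    rw [← Finset.mul_sum, sum_chiZ_mul_exp_eq_gaussSum χ hprim (k + 1)]
    ring
  simp_rw [inner]
  rw [tsum_mul_left]
  ring

/-! ### Double series to divisor sums -/

/-- **`∑_{a ≥ 1} ∑_{b ≥ 1} w(b) q^{ab} = ∑_{m ≥ 1} (∑_{d ∣ m} w(d)) qᵐ`** for `|q| < 1` and a
bounded weight `w` (absolute convergence and Mathlib's `sigmaAntidiagonalEquivProd`). [folklore] -/
theorem tsum_tsum_mul_pow_eq_tsum_divisorSum {q : ℂ} (hq : ‖q‖ < 1) (w : ℕ → ℂ) {B : ℝ}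
    (hw : ∀ b, ‖w b‖ ≤ B) :
    ∑' a : ℕ, ∑' b : ℕ, w (b + 1) * q ^ ((b + 1) * (a + 1)) =
      ∑' m : ℕ, (∑ d ∈ (m + 1).divisors, w d) * q ^ (m + 1) := by
  have hB : 0 ≤ B := (norm_nonneg _).trans (hw 0)
  -- the summable family on `ℕ+ × ℕ+`
  set f : ℕ+ × ℕ+ → ℂ := fun c ↦ w c.2 * q ^ ((c.1 : ℕ) * c.2) with hf
  have hf0 : Summable fun c : ℕ+ × ℕ+ ↦ (c.2 : ℂ) ^ 0 * q ^ ((c.1 : ℕ) * c.2 : ℕ) :=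
    summable_prod_mul_pow 0 hq
  have hfs : Summable f := by
    refine Summable.of_norm_bounded (g := fun c : ℕ+ × ℕ+ ↦ B * ‖q ^ ((c.1 : ℕ) * c.2 : ℕ)‖)
      ((hf0.norm.mul_left B).congr fun c ↦ by simp) fun c ↦ ?_
    rw [hf, norm_mul]
    exact mul_le_mul_of_nonneg_right (hw _) (norm_nonneg _)
  -- left side as the sum over `ℕ+ × ℕ+`
  have hleft : ∑' a : ℕ, ∑' b : ℕ, w (b + 1) * q ^ ((b + 1) * (a + 1)) = ∑' c : ℕ+ × ℕ+, f c := by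
    rw [hfs.tsum_prod]
    rw [← tsum_pnat_eq_tsum_succ (f := fun a : ℕ ↦ ∑' b : ℕ, w (b + 1) * q ^ ((b + 1) * a))]
    refine tsum_congr fun a ↦ ?_
    rw [← tsum_pnat_eq_tsum_succ (f := fun b : ℕ ↦ w b * q ^ (b * (a : ℕ)))]
    refine tsum_congr fun b ↦ ?_
    simp [hf, mul_comm]
  -- right side via the antidiagonal decomposition
  have hright : ∑' c : ℕ+ × ℕ+, f c = ∑' m : ℕ, (∑ d ∈ (m + 1).divisors, w d) * q ^ (m + 1) := by
    rw [← sigmaAntidiagonalEquivProd.tsum_eq]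
    have hs : Summable (f ∘ sigmaAntidiagonalEquivProd) :=
      sigmaAntidiagonalEquivProd.summable_iff.mpr hfs
    rw [show (fun x ↦ f (sigmaAntidiagonalEquivProd x)) = f ∘ sigmaAntidiagonalEquivProd from rfl,
      hs.tsum_sigma]
    rw [← tsum_pnat_eq_tsum_succ (f := fun m : ℕ ↦ (∑ d ∈ m.divisors, w d) * q ^ m)]
    refine tsum_congr fun m ↦ ?_
    rw [tsum_fintype]
    -- the fibre over `m` is `divisorsAntidiagonal m`, attached
    have h1 : ∑ x : (Nat.divisorsAntidiagonal (m : ℕ)),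
        (f ∘ sigmaAntidiagonalEquivProd) (⟨m, x⟩ : Σ n : ℕ+, Nat.divisorsAntidiagonal (n : ℕ)) =
        ∑ x ∈ (m : ℕ).divisorsAntidiagonal, w x.2 * q ^ (x.1 * x.2) := by
      rw [← Finset.sum_attach ((m : ℕ).divisorsAntidiagonal)
        (fun y : ℕ × ℕ ↦ w y.2 * q ^ (y.1 * y.2)), Finset.univ_eq_attach]
      refine Finset.sum_congr rfl fun x _ ↦ ?_
      simp [hf, sigmaAntidiagonalEquivProd, divisorsAntidiagonalFactors]
    rw [h1, Nat.sum_divisorsAntidiagonal' (fun a b ↦ w b * q ^ (a * b)), Finset.sum_mul]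
    refine Finset.sum_congr rfl fun d hd ↦ ?_
    rw [Nat.div_mul_cancel (Nat.dvd_of_mem_divisors hd)]
  rw [hleft, hright]

/-! ### The `q`-expansion of `G̃(z, 0)` -/

/-- **The `q`-expansion at `s = 0`**: for a primitive odd `χ` mod `M`,
`G̃(z, 0) = 2 L(χ, 1) - (4πi τ(χ)/M) ∑_{m ≥ 1} (∑_{d ∣ m} χ̄(d)) qᵐ` (Hecke 1927, (13); Miyake
Thm 7.2.13, `k = 1`). [folklore] -/
theorem eisensteinOneCont_zero_qExpansion (hprim : χ.IsPrimitive) (hodd : χ.Odd) (z : ℍ) :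
    eisensteinOneCont χ z 0 = 2 * χ.LFunction 1 -
      (4 * π * Complex.I * gaussSum χ (ZMod.stdAddChar (N := M)) / M) *
        ∑' m : ℕ, (∑ d ∈ (m + 1).divisors, χ⁻¹ (d : ZMod M)) *
          Complex.exp (2 * π * Complex.I * z) ^ (m + 1) := by
  have hχ := ne_one_of_odd χ hodd
  have hq : ‖Complex.exp (2 * π * Complex.I * z)‖ < 1 := UpperHalfPlane.norm_exp_two_pi_I_lt_one z
  rw [eisensteinOneCont_zero χ hodd z]
  simp_rw [rowValue_zero_eq χ hprim hχ]
  rw [tsum_mul_left]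
  have hw : ∀ b : ℕ, ‖χ⁻¹ (b : ZMod M)‖ ≤ 1 := fun b ↦ DirichletCharacter.norm_le_one _ _
  have h := tsum_tsum_mul_pow_eq_tsum_divisorSum hq (fun b : ℕ ↦ χ⁻¹ (b : ZMod M)) hw
  simp only [Nat.cast_add, Nat.cast_one] at h ⊢
  rw [show (∑' a : ℕ, ∑' k : ℕ, χ⁻¹ ((k : ZMod M) + 1) *
      Complex.exp (2 * π * Complex.I * z) ^ ((k + 1) * (a + 1))) =
      ∑' m : ℕ, (∑ d ∈ (m + 1).divisors, χ⁻¹ (d : ZMod M)) *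
        Complex.exp (2 * π * Complex.I * z) ^ (m + 1) by simpa using h]
  ring

end Literature.NumberTheory.EllipticCurves.ModularForms
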